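import Literature.NumberTheory.Automorphic.AutomorphicGLnFlathExistsProofs
import HarnessLib

/-!
# `flath_exists` with its topological-group hypothesis restored (corrected named fact)

Topic `NumberTheory/Automorphic`. The named fact `Literature.NumberTheory.Automorphic.flath_exists`
(`AutomorphicGLn`, **lang.S19**: Flath's tensor product theorem, existence; Flath, Corvallis 1979,
Thm. 3; Bump 1997, Thm. 3.4.4) was written in a section declaring
`[∀ i, NonarchimedeanGroup (G i)] [∀ i, LocallyCompactSpace (G i)] [∀ i, T2Space (G i)]`, but a
`def` only absorbs the section variables its body uses: the three instance binders were silently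
dropped and the constant quantifies over arbitrary topological spaces on the groups `G i`. The
sibling `AutomorphicGLnFlathExistsProofs` proves `flath_exists` for every family of *topological groups*
(`flath_exists_holds_of_isTopologicalGroup`); this file records the corresponding closed statement
`flath_exists_of_isTopologicalGroup` — verbatim `flath_exists` behind the single restored binder
`[∀ i, IsTopologicalGroup (G i)]`, which is all the proof uses and which the source's totally
disconnected locally compact groups satisfy — and discharges it. Nothing else is claimed; in
particular whether the binder-free constant holds for non-group topologies is left open.

## References

* D. Flath, *Decomposition of representations into tensor products*, Proc. Sympos. Pure Math. 33
  (1979), part 1, 179–183, Thm. 3 [FlathCorvallis1979].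
* D. Bump, *Automorphic forms and representations* (1997), Thm. 3.4.4, Prop. 3.4.9 [Bump1997].
-/

open scoped RestrictedProduct

namespace Literature.NumberTheory.Automorphic

universe u v w

section Corrected

/-- **Corrected form of the named fact `flath_exists` (restored hypothesis).** The constant
`flath_exists` of `AutomorphicGLn` was written in a section declaring
`[∀ i, NonarchimedeanGroup (G i)] [∀ i, LocallyCompactSpace (G i)] [∀ i, T2Space (G i)]`, and its
docstring says "let `(G i)` be locally profinite groups"; but a `def` only absorbs the section
variables its body uses, so these three instance binders were silently dropped and the constant
quantifies over *arbitrary* topological spaces on the groups `G i` (no compatibility of the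
topology with the group law is assumed). Whether that binder-free statement is provable is not
known to us; it is not the statement of the source (Flath 1979, Example 2 and Thm. 3: totally
disconnected locally compact groups; Bump 1997, Prop. 3.4.9 and Thm. 3.4.4), cf. the identical
defect recorded for `Representation.isAdmissible_jacquetModule` in `JacquetLemma`. The present
fact restores the one hypothesis the proof uses — `[∀ i, IsTopologicalGroup (G i)]` (translations
continuous, so that open subgroups of the compact `K i` have finite index, the double cosets
`K_i g K_i` are finite unions of left cosets, and open subgroups of `Πʳ i, [G i, K i]` contain
compact open box subgroups) — and is otherwise verbatim `flath_exists`; it is *fully closed* (the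
index type, the groups, their topologies, the level subgroups, the space and all instance
hypotheses are binders of the `Prop` itself, so nothing can be dropped again), implies the source's
statement, and is discharged by `flath_exists_of_isTopologicalGroup_holds`.
[cite: FlathCorvallis1979, Theorem 3] -/
def flath_exists_of_isTopologicalGroup : Prop :=
  ∀ {ι : Type u} [DecidableEq ι] {G : ι → Type v} [∀ i, Group (G i)] [∀ i, TopologicalSpace (G i)]
    [∀ i, IsTopologicalGroup (G i)] {K : ∀ i, Subgroup (G i)} {W : Type w} [AddCommGroup W]
    [Module ℂ W], flath_exists (ι := ι) (G := G) (K := K) (W := W)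

/-- **Discharge** of `flath_exists_of_isTopologicalGroup`: Flath's tensor product theorem
(existence half) for restricted products of topological groups with respect to compact open
subgroups, almost all Gelfand pairs, by `flath_exists_holds_of_isTopologicalGroup`.
[cite: FlathCorvallis1979, Theorem 3] -/
theorem flath_exists_of_isTopologicalGroup_holds : flath_exists_of_isTopologicalGroup := by
  intro ι _ G _ _ _ K W _ _
  exact flath_exists_holds_of_isTopologicalGroup

end Corrected

end Literature.NumberTheory.Automorphic
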